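import Summits.BirchSwinnertonDyer.BirchSwinnertonDyer.Theorems.PrintCf2RamifiedOffTYZHalfNormTransfer
import HarnessLib

/-!
# Route `PrintCf2`, crux stmt-BirchSwinnertonDyer-20509 `RamifiedOffTYZOfFacts`, THEOREM A's steps (R5)+(R8) in the kernel: the CM-side assembly —
# from «every `g^{#T}` fixes `s₀`» and the transport of the orbit product along two embeddings into `ℂ`, the realisation's orbit product is a square
# over `k₀` (cell `bsd-print-cf2`, LEAD cruxlead-20509 g32, line `offtyz-v7`, lineage cycle 33; fact-free, Theses-free, `def`-free)

HONEST FRAMING (`--supports stmt-BirchSwinnertonDyer-20509`; theorems only).  BSD is not proved by any of this; no class is closed by this file;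
item 23431 (C⁺) and crux 20509 stay OPEN.  Steps (R5) (half-norm) and (R8) (pull-back along the embeddings) of THEOREM A's kernel road
(memo `Cruxes/RamifiedOffTYZOfFacts/Lines/offtyz_v7_TheoremARoad.md` §3, §3c), ABSTRACTLY: two fields `M` (the realisation's field) and `R` (the ray class
field `K^{(32)}`), ring embeddings `j : M → ℂ`, `e : R → ℂ`; a commutative group `G` acting on `R` by ring automorphisms (`Gal(R/L₁)`), `s₀ ∈ R`
(`e s₀ = s(τ_n)`), a subgroup `H ≤ G` acting on `s₀` by signs with a transversal `T`; a subset `k₀ ⊆ M` (the fixed field `M^N`) such that every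
`G`-invariant element of `R` is, in `ℂ`, the image of an element of `k₀` (`e(R^G) ⊆ j(k₀)`: `L₁ ↔ k₀`); and an element `Q ∈ M` (the orbit product
`∏_{x ∈ N•x₀} x`) with `j Q = e(∏_{t∈T} t•(s₀²))` (transport of the orbit product: both are the product of the conjugates of `X(τ_n)` over `ℚ(i,√l,√−q)`).

* ★ `orbitProd_sq_of_halfNorm_transport` — **if every `g^{#T}` fixes `s₀`, then `Q = m²` for some `m ∈ k₀`.**  (`HalfNormTransfer.halfNorm_mem_fixed_of_forall_pow_card_smul`:
  the half-norm `P = ∏_{t∈T} t•s₀` is `G`-invariant, so `e P = j m` with `m ∈ k₀`; `j(m²) = e(P²) = e(∏ t•s₀²) = j Q`; `j` is injective.)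
* `orbitProd_sq_of_even_of_sq_smul_ne` — the same from the ORDER-TWO CRITERION (`#T` even, no `g` with `g²•s₀ = −s₀`).

With `TheoremAOrbitReduction.firstNorm_sq_of_orbit_sq` (p811971: THEOREM A ⟸ the orbit product `∏_{x∈N•x₀} x` is a square over `k₀`) THIS closes the LOGICAL
skeleton of THEOREM A in the kernel; what remains are the three ARITHMETIC inputs, now with exact types: (T1) the transport `j Q = e(∏_{t∈T} t•a₀)` and
`e(R^G) ⊆ j(k₀)` (Galois theory of `M ↔ ℂ ↔ K^{(32)}`: both sides are the conjugates of `X(τ_n)` over `ℚ(i,√l,√−q)`); (T2) `#T = #G•a₀ = g(n)` ((R3)/(R4));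
(T3) `∀ g ∈ G, g^{g(n)}•s₀ = s₀` ((R2′), from `TheoremAReciprocity` p811633 + the genus character + ambiguous classes).  PROOFS ONLY.

References: [cite: NeukirchSchmidtWingberg2008, §1.5 (cor = N on Kummer classes)]; transfer in an abelian group is the power map [folklore]; tree p810950.
-/

namespace Summit.BirchSwinnertonDyer.PrintCf2.TheoremACMAssembly

open Finset Summit.BirchSwinnertonDyer.PrintCf2.HalfNormTransfer

variable {M R G : Type*} [Field M] [CommRing R] [CommGroup G] [MulSemiringAction G R]

/-- ★ **CM-side assembly.**  `H` acts on `s₀` by signs, `T` a transversal of `H` in the commutative group `G`, every `g^{#T}` fixes `s₀`; `k₀ ⊆ M` with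
`e(R^G) ⊆ j(k₀)`; `j Q = e(∏_{t∈T} t•(s₀ s₀))`.  Then `Q = m²` with `m ∈ k₀`. [folklore] [cite: NeukirchSchmidtWingberg2008, §1.5] -/
theorem orbitProd_sq_of_halfNorm_transport (j : M →+* ℂ) (e : R →+* ℂ)
    {H : Subgroup G} {s₀ : R} (hH : ∀ h ∈ H, h • s₀ = s₀ ∨ h • s₀ = -s₀)
    {T : Finset G} (hT : ∀ g : G, ∃! t, t ∈ T ∧ t⁻¹ * g ∈ H) (hpow : ∀ g : G, (g ^ T.card) • s₀ = s₀)
    (k₀ : Set M) (hfix : ∀ r : R, (∀ g : G, g • r = r) → ∃ m ∈ k₀, j m = e r)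
    {Q : M} (hQ : j Q = e (∏ t ∈ T, t • (s₀ * s₀))) :
    ∃ m ∈ k₀, Q = m ^ 2 := by
  -- the half-norm is `G`-invariant
  have hP : ∀ g : G, g • (∏ t ∈ T, t • s₀) = ∏ t ∈ T, t • s₀ := halfNorm_mem_fixed_of_forall_pow_card_smul hH hT hpow
  obtain ⟨m, hm, hjm⟩ := hfix _ hP
  refine ⟨m, hm, j.injective ?_⟩
  rw [map_pow, hjm, sq, ← map_mul, halfNorm_sq, hQ]

/-- **The same from the order-two criterion**: `#T` even and no `g ∈ G` with `g²•s₀ = −s₀`. [folklore] [cite: NeukirchSchmidtWingberg2008, §1.5] -/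
theorem orbitProd_sq_of_even_of_sq_smul_ne (j : M →+* ℂ) (e : R →+* ℂ)
    {H : Subgroup G} {s₀ : R} (hH : ∀ h ∈ H, h • s₀ = s₀ ∨ h • s₀ = -s₀)
    {T : Finset G} (hT : ∀ g : G, ∃! t, t ∈ T ∧ t⁻¹ * g ∈ H) (heven : Even T.card) (hsq : ∀ g : G, (g * g) • s₀ ≠ -s₀)
    (k₀ : Set M) (hfix : ∀ r : R, (∀ g : G, g • r = r) → ∃ m ∈ k₀, j m = e r)
    {Q : M} (hQ : j Q = e (∏ t ∈ T, t • (s₀ * s₀))) :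
    ∃ m ∈ k₀, Q = m ^ 2 :=
  orbitProd_sq_of_halfNorm_transport j e hH hT (pow_card_smul_eq_of_even_of_sq_smul_ne hH hT heven hsq) k₀ hfix hQ

/-- **The stabiliser of `a₀ = s₀²` acts on `s₀` by signs** (in a domain): the hypothesis `hH` of the assembly for `H ≤ Stab_G(s₀²)`. [folklore] -/
theorem smul_eq_self_or_neg_of_smul_sq_eq [IsDomain R] {g : G} {s₀ : R} (h : g • (s₀ * s₀) = s₀ * s₀) :
    g • s₀ = s₀ ∨ g • s₀ = -s₀ := by
  rw [smul_mul'] at h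
  exact mul_self_eq_mul_self_iff.mp h

end Summit.BirchSwinnertonDyer.PrintCf2.TheoremACMAssembly
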